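import Literature.AlgebraicGeometry.Frobenioids.Composites
import Literature.AlgebraicGeometry.Frobenioids.IsometricPreSteps
import Literature.AlgebraicGeometry.Frobenioids.CategoryTheoreticityFacts
import Literature.AlgebraicGeometry.Frobenioids.EquivalenceTransportAnchors
import HarnessLib

/-!
# Frobenioids I, §3: proofs of the category-theoreticity facts — Theorem 3.4 (i)

Mochizuki, *The geometry of Frobenioids I: the general theory*, Kyushu J. Math. **62** (2008),
Thm. 3.4 (i), statement kurims p. 62, proof p. 63 [cite: MochizukiFrdI2008, Thm. 3.4 (i) p.63]:
"Since iso-subanchors are manifestly preserved by any equivalence of categories, it follows from our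
assumption that `C₁`, `C₂` are of quasi-isotropic type that `Ψ` preserves isotropic objects. Now …
the remainder of assertion (i) follows formally from [the definitions and] Proposition 1.9, (v), (vi),
(vii)."

PROOF-ONLY companion of `CategoryTheoreticityFacts.lean` / `BaseCategoryTheoreticity.lean` (seat
abc-iut-L1-t3; statements untouched): this file DISCHARGES the named fact `FrdI.Thm34i` (Thm. 3.4 (i),
preservation part: an equivalence `Ψ : C₁ ⥲ C₂` between Frobenioids of quasi-isotropic type preserves
isotropic objects, isotropic hulls and isometric pre-steps) as `FrdI.Thm34i_holds`.

Route (as printed): isotropic objects via iso-subanchors (`isIsoSubanchor_obj_iff`,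
`EquivalenceTransportAnchors.lean`); isotropic hulls via the characterisation of Prop. 1.9 (vi)
("isotropic hull ⟺ isotropic codomain and minimal-coadjoint to the arrows with isotropic domain") and
the transport of minimal-coadjointness; isometric pre-steps via Prop. 1.9 (vii) ("isometric pre-step ⟺
its composite with an isotropic hull of the codomain is an isotropic hull"); both characterisations are
seat abc-iut-L1-t1's (`IsometricPreSteps.lean`). Also two adapter `Iff`s for `PreFrobenioidData.ofFunctor`
(isometric pre-steps, isotropic hulls) complementing `PreFrobenioidDataOfFunctor.lean`. No statement of
the paper is restated or strengthened.
-/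

-- Compositions with `e.unit.app _`/isomorphism components have implicit objects that only unfold at
-- default transparency (as in Mathlib's `Equivalence` files and `EquivalenceTransportAnchors.lean`).
set_option backward.isDefEq.respectTransparency false

namespace Literature.AlgebraicGeometry.Frobenioids

open CategoryTheory Opposite

universe w v v' u u'

/-! ### Two more adapter `Iff`s for `PreFrobenioidData.ofFunctor` -/

namespace PreFrobenioidData

variable {D : Type u} [Category.{v} D] {Φ : Dᵒᵖ ⥤ CommMonCat.{w}}
  {C : Type u'} [Category.{v'} C] (F : C ⥤ ElemFrobenioid Φ)

/-- Isometric pre-step, through the adapter. [cite: MochizukiFrdI2008, Def. 1.2 (iii) p.22] -/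
theorem ofFunctor_isIsometricPreStep {A B : C} (φ : A ⟶ B) :
    (ofFunctor Φ F).IsIsometricPreStep φ ↔
      PreFrobenioid.IsPreStep F φ ∧ PreFrobenioid.IsIsometry F φ := Iff.rfl

/-- Isotropic hull, through the adapter. [cite: MochizukiFrdI2008, Def. 1.2 (iv) p.23] -/
theorem ofFunctor_isIsotropicHull {A B : C} (φ : A ⟶ B) :
    (ofFunctor Φ F).IsIsotropicHull φ ↔ PreFrobenioid.IsIsotropicHull F φ := by
  constructor
  · rintro ⟨⟨hp, hi⟩, hB, hu⟩
    exact ⟨hi, hp, (ofFunctor_isIsotropic F B).1 hB,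
      fun X γ hX => hu γ ((ofFunctor_isIsotropic F X).2 hX)⟩
  · rintro ⟨hi, hp, hB, hu⟩
    exact ⟨⟨hp, hi⟩, (ofFunctor_isIsotropic F B).2 hB,
      fun X γ hX => hu γ ((ofFunctor_isIsotropic F X).1 hX)⟩

end PreFrobenioidData

/-! ### Theorem 3.4 (i): the transport lemmas for two Frobenioids of quasi-isotropic type -/

namespace FrdI

section TwoFrobenioids

variable {D₁ : Type u} [Category.{v} D₁] {Φ₁ : D₁ᵒᵖ ⥤ CommMonCat.{w}} {C₁ : Type u'}
  [Category.{v'} C₁] {D₂ : Type u} [Category.{v} D₂] {Φ₂ : D₂ᵒᵖ ⥤ CommMonCat.{w}} {C₂ : Type u'}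
  [Category.{v'} C₂] {F₁ : C₁ ⥤ ElemFrobenioid Φ₁} {F₂ : C₂ ⥤ ElemFrobenioid Φ₂}

/-- Thm. 3.4 (i), first clause: an equivalence between (pre-)Frobenioids of quasi-isotropic type
carries isotropic objects to isotropic objects ("since iso-subanchors are manifestly preserved by any
equivalence of categories"). [cite: MochizukiFrdI2008, Thm. 3.4 (i) p.63] -/
theorem isIsotropic_map (hq₁ : (PreFrobenioidData.ofFunctor Φ₁ F₁).IsOfQuasiIsotropicType)
    (hq₂ : (PreFrobenioidData.ofFunctor Φ₂ F₂).IsOfQuasiIsotropicType) (Ψ : C₁ ≌ C₂) {A : C₁}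
    (hA : PreFrobenioid.IsIsotropic F₁ A) : PreFrobenioid.IsIsotropic F₂ (Ψ.functor.obj A) := by
  rw [← PreFrobenioidData.ofFunctor_isIsotropic] at hA ⊢
  by_contra h
  exact (hq₁.nonIsotropic_iff A).2
    ((isIsoSubanchor_obj_iff Ψ A).1 ((hq₂.nonIsotropic_iff _).1 h)) hA

/-- Thm. 3.4 (i), second clause: an equivalence between Frobenioids of quasi-isotropic type carries
isotropic hulls to isotropic hulls (Prop. 1.9 (vi) and transport of minimal-coadjointness).
[cite: MochizukiFrdI2008, Thm. 3.4 (i) p.63] -/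
theorem isIsotropicHull_map (hF₁ : PreFrobenioid.IsFrobenioid F₁) (hF₂ : PreFrobenioid.IsFrobenioid F₂)
    (hq₁ : (PreFrobenioidData.ofFunctor Φ₁ F₁).IsOfQuasiIsotropicType)
    (hq₂ : (PreFrobenioidData.ofFunctor Φ₂ F₂).IsOfQuasiIsotropicType) (Ψ : C₁ ≌ C₂) {A B : C₁}
    {φ : A ⟶ B} (hφ : PreFrobenioid.IsIsotropicHull F₁ φ) :
    PreFrobenioid.IsIsotropicHull F₂ (Ψ.functor.map φ) := by
  have hB : PreFrobenioid.IsIsotropic F₂ (Ψ.functor.obj B) := by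
    obtain ⟨-, -, hB, -⟩ := id hφ
    exact isIsotropic_map hq₁ hq₂ Ψ hB
  have hmin := ((PreFrobenioid.isIsotropicHull_iff_isMinimalCoadjoint hF₁ φ).1 hφ).2.map_equivalence Ψ
    (S₂ := fun (X Y : C₂) (_ : X ⟶ Y) => PreFrobenioid.IsIsotropic F₂ X)
    (fun X Y β hX => isIsotropic_map hq₂ hq₁ Ψ.symm hX) (fun X Y Y' β j _ hX => hX)
  exact (PreFrobenioid.isIsotropicHull_iff_isMinimalCoadjoint hF₂ _).2 ⟨hB, hmin⟩

/-- Thm. 3.4 (i), third clause: an equivalence between Frobenioids of quasi-isotropic type carries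
isometric pre-steps to isometric pre-steps (Prop. 1.9 (vii)). [cite: MochizukiFrdI2008, Thm. 3.4 (i) p.63] -/
theorem isIsometry_isPreStep_map (hF₁ : PreFrobenioid.IsFrobenioid F₁)
    (hF₂ : PreFrobenioid.IsFrobenioid F₂)
    (hq₁ : (PreFrobenioidData.ofFunctor Φ₁ F₁).IsOfQuasiIsotropicType)
    (hq₂ : (PreFrobenioidData.ofFunctor Φ₂ F₂).IsOfQuasiIsotropicType) (Ψ : C₁ ≌ C₂) {A B : C₁}
    {φ : A ⟶ B} (hi : PreFrobenioid.IsIsometry F₁ φ) (hp : PreFrobenioid.IsPreStep F₁ φ) :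
    PreFrobenioid.IsIsometry F₂ (Ψ.functor.map φ) ∧ PreFrobenioid.IsPreStep F₂ (Ψ.functor.map φ) := by
  obtain ⟨B', h, hh⟩ := hF₁.vii_a B
  have h3 := isIsotropicHull_map hF₁ hF₂ hq₁ hq₂ Ψ
    (PreFrobenioid.IsIsometricPreStep.comp_isIsotropicHull hF₁ ⟨hi, hp⟩ hh)
  rw [Functor.map_comp] at h3
  exact PreFrobenioid.isIsometricPreStep_of_comp_isIsotropicHull hF₂.isPreFrobenioid h3

/-! ### Remark 3.4.1: the transport lemmas -/

/-- If `Ψ⁻¹` preserves linear morphisms then `Ψ` preserves morphisms of Frobenius type (Prop. 1.7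
(iii): Frobenius type ⟺ minimal-coadjoint to the linear morphisms; used in Rem. 3.4.1).
[cite: MochizukiFrdI2008, Rem. 3.4.1 p.69] -/
theorem isFrobeniusType_map_of_linear (hF₁ : PreFrobenioid.IsFrobenioid F₁)
    (hF₂ : PreFrobenioid.IsFrobenioid F₂) (Ψ : C₁ ≌ C₂)
    (hlin : ∀ ⦃X Y : C₂⦄ (β : X ⟶ Y), PreFrobenioid.IsLinear F₂ β →
      PreFrobenioid.IsLinear F₁ (Ψ.inverse.map β))
    {A B : C₁} {φ : A ⟶ B} (hφ : PreFrobenioid.IsFrobeniusType F₁ φ) :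
    PreFrobenioid.IsFrobeniusType F₂ (Ψ.functor.map φ) := by
  rw [PreFrobenioid.isFrobeniusType_iff_isMinimalCoadjoint F₂ hF₂]
  rw [PreFrobenioid.isFrobeniusType_iff_isMinimalCoadjoint F₁ hF₁] at hφ
  refine hφ.map_equivalence Ψ (S₂ := PreFrobenioid.linearMorphisms F₂) (fun X Y β hβ => hlin β hβ)
    (fun X Y Y' β j hj hβ => ?_)
  haveI := hj
  exact PreFrobenioid.IsLinear.comp F₁ hβ (PreFrobenioid.isLinear_of_isIso F₁ j)

/-- Rem. 3.4.1 for one direction: between Frobenioids of group-like and quasi-isotropic type, if `Ψ⁻¹`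
preserves linear morphisms then `Ψ` preserves base-isomorphisms. Route: `φ = pull-back ∘ pre-step ∘
Frobenius-type` (Def. 1.3 (iv)(a)) with the pull-back factor an isomorphism (Rem. 1.2.1); the
Frobenius-type factor by `isFrobeniusType_map_of_linear`; the pre-step `β : X → Y` through isotropic
hulls `X → X'`, `Y → Y'` (Thm. 3.4 (i)): the induced `X' → Y'` is an isometric (group-like!) pre-step of
isotropic domain, hence an isomorphism. [cite: MochizukiFrdI2008, Rem. 3.4.1 p.69] -/
theorem isBaseIso_map_of_groupLike (hF₁ : PreFrobenioid.IsFrobenioid F₁)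
    (hF₂ : PreFrobenioid.IsFrobenioid F₂) (hg₁ : ∀ A : C₁, PreFrobenioid.IsGroupLikeObj F₁ A)
    (hq₁ : (PreFrobenioidData.ofFunctor Φ₁ F₁).IsOfQuasiIsotropicType)
    (hq₂ : (PreFrobenioidData.ofFunctor Φ₂ F₂).IsOfQuasiIsotropicType) (Ψ : C₁ ≌ C₂)
    (hlin : ∀ ⦃X Y : C₂⦄ (β : X ⟶ Y), PreFrobenioid.IsLinear F₂ β →
      PreFrobenioid.IsLinear F₁ (Ψ.inverse.map β))
    {A B : C₁} {φ : A ⟶ B} (hφ : PreFrobenioid.IsBaseIso F₁ φ) :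
    PreFrobenioid.IsBaseIso F₂ (Ψ.functor.map φ) := by
  have hD₁ := hF₁.isPreFrobenioid.isTotallyEpimorphic_base
  have hD₂ := hF₂.isPreFrobenioid.isTotallyEpimorphic_base
  obtain ⟨X, Y, γ, β, α, hfac, hγ, hβ, hα⟩ := hF₁.iv_a_exists φ
  -- the pull-back factor is an isomorphism
  have hαb : PreFrobenioid.IsBaseIso F₁ α := by
    rw [← hfac] at hφ
    exact (PreFrobenioid.isBaseIso_factors F₁ hD₁ (PreFrobenioid.isBaseIso_factors F₁ hD₁ hφ).1).1
  haveI : IsIso α := (PreFrobenioid.isPullbackMorphism_and_isBaseIso_iff_isIso F₁ α).1 ⟨hα, hαb⟩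
  -- the Frobenius-type factor
  have h1 : PreFrobenioid.IsBaseIso F₂ (Ψ.functor.map γ) :=
    (isFrobeniusType_map_of_linear hF₁ hF₂ Ψ hlin hγ).2
  -- the pre-step factor, through isotropic hulls
  have h2 : PreFrobenioid.IsBaseIso F₂ (Ψ.functor.map β) := by
    obtain ⟨X', hX, hhX⟩ := hF₁.vii_a X
    obtain ⟨Y', hY, hhY⟩ := hF₁.vii_a Y
    obtain ⟨-, hYp, hY'iso, -⟩ := id hhY
    obtain ⟨-, -, hX'iso, hunivX⟩ := id hhX
    obtain ⟨β', hβ', -⟩ := hunivX (β ≫ hY) hY'iso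
    have hβ'p : PreFrobenioid.IsPreStep F₁ β' :=
      (PreFrobenioid.isPreStep_factors F₁ hD₁ (show PreFrobenioid.IsPreStep F₁ (hX ≫ β') by
        rw [hβ']; exact PreFrobenioid.IsPreStep.comp F₁ hβ hYp)).1
    have hβ'i : PreFrobenioid.IsIsometry F₁ β' := hg₁ X' (PreFrobenioid.Div F₁ β')
    haveI : IsIso β' := hX'iso β' hβ'i hβ'p
    obtain ⟨-, hΨhXp, -, -⟩ := isIsotropicHull_map hF₁ hF₂ hq₁ hq₂ Ψ hhX
    have hcomp : PreFrobenioid.IsBaseIso F₂ (Ψ.functor.map (β ≫ hY)) := by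
      rw [← hβ', Functor.map_comp]
      exact PreFrobenioid.IsBaseIso.comp F₂ hΨhXp.2 (PreFrobenioid.isBaseIso_of_isIso F₂ _)
    rw [Functor.map_comp] at hcomp
    exact (PreFrobenioid.isBaseIso_factors F₂ hD₂ hcomp).2
  rw [← hfac, Functor.map_comp, Functor.map_comp]
  exact PreFrobenioid.IsBaseIso.comp F₂ h1
    (PreFrobenioid.IsBaseIso.comp F₂ h2 (PreFrobenioid.isBaseIso_of_isIso F₂ _))

end TwoFrobenioids

/-! ### The named facts, discharged -/

/-- **[FrdI] Theorem 3.4 (i), preservation part — DISCHARGED**: for Frobenioids `C₁ → F_{Φ₁}`,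
`C₂ → F_{Φ₂}` of quasi-isotropic type and an equivalence `Ψ : C₁ ⥲ C₂`, `Ψ` preserves the isotropic
objects, isotropic hulls and isometric pre-steps (kurims p. 62; proof p. 63 via iso-subanchors and
Prop. 1.9 (vi), (vii)). [cite: MochizukiFrdI2008, Thm. 3.4 (i) p.62] -/
theorem Thm34i_holds : Thm34i.{w, v, v', u, u'} := by
  intro D₁ _ Φ₁ C₁ _ D₂ _ Φ₂ C₂ _ F₁ F₂ hF₁ hF₂ Ψ hq₁ hq₂
  refine ⟨fun A hA => ?_, fun A B φ hφ => ?_, fun A B φ hφ => ?_⟩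
  · exact (PreFrobenioidData.ofFunctor_isIsotropic F₂ _).2
      (isIsotropic_map hq₁ hq₂ Ψ ((PreFrobenioidData.ofFunctor_isIsotropic F₁ A).1 hA))
  · exact (PreFrobenioidData.ofFunctor_isIsotropicHull F₂ _).2
      (isIsotropicHull_map hF₁ hF₂ hq₁ hq₂ Ψ
        ((PreFrobenioidData.ofFunctor_isIsotropicHull F₁ φ).1 hφ))
  · obtain ⟨hp, hi⟩ := (PreFrobenioidData.ofFunctor_isIsometricPreStep F₁ φ).1 hφ
    obtain ⟨hi₂, hp₂⟩ := isIsometry_isPreStep_map hF₁ hF₂ hq₁ hq₂ Ψ hi hp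
    exact (PreFrobenioidData.ofFunctor_isIsometricPreStep F₂ _).2 ⟨hp₂, hi₂⟩

/-- **[FrdI] Remark 3.4.1 — DISCHARGED**: between Frobenioids of group-like and quasi-isotropic type,
if `Ψ` and (the chosen) quasi-inverse preserve Frobenius degrees then they preserve base-isomorphisms
(kurims p. 69). The printed argument reduces to isotropic type by Thm. 3.4 (i); here the reduction is
carried out arrow-wise through isotropic hulls (see `isBaseIso_map_of_groupLike`).
[cite: MochizukiFrdI2008, Rem. 3.4.1 p.69] -/
theorem Remark341_holds : Remark341.{w, v, v', u, u'} := by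
  intro D₁ _ Φ₁ C₁ _ D₂ _ Φ₂ C₂ _ F₁ F₂ hF₁ hF₂ Ψ hg₁ hg₂ hq₁ hq₂ hd hd'
  have hlin₁₂ : ∀ ⦃A B : C₁⦄ (φ : A ⟶ B), PreFrobenioid.IsLinear F₁ φ →
      PreFrobenioid.IsLinear F₂ (Ψ.functor.map φ) := fun A B φ h => by
    change PreFrobenioid.degFr F₂ (Ψ.functor.map φ) = 1
    exact (hd φ).trans h
  have hlin₂₁ : ∀ ⦃X Y : C₂⦄ (β : X ⟶ Y), PreFrobenioid.IsLinear F₂ β →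
      PreFrobenioid.IsLinear F₁ (Ψ.inverse.map β) := fun X Y β h => by
    change PreFrobenioid.degFr F₁ (Ψ.inverse.map β) = 1
    exact (hd' β).trans h
  exact ⟨fun A B φ hφ => isBaseIso_map_of_groupLike hF₁ hF₂ (fun A => hg₁.obj A) hq₁ hq₂ Ψ hlin₂₁ hφ,
    fun X Y φ hφ => isBaseIso_map_of_groupLike hF₂ hF₁ (fun A => hg₂.obj A) hq₂ hq₁ Ψ.symm hlin₁₂ hφ⟩

end FrdI

end Literature.AlgebraicGeometry.Frobenioids
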